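import Mathlib.Algebra.CharP.Lemmas
import Mathlib.RingTheory.Filtration
import Mathlib.FieldTheory.IsAlgClosed.Basic
import Mathlib.RingTheory.LocalRing.MaximalIdeal.Basic
import HarnessLib

/-!
# Route `EquisingularLift`, crux EL♮(3) (stmt-ResolutionOfSingularities-20148) / EL♮ (stmt-…-20038) — rung TOWER₁: the `ConeForm` coefficient clause
# «infinitely root-divisible ⇒ constant» (the one new brick res-type-100's B9-adapted frame needs; …NatTowerConeDefs p552864, module docstring)

res-L1-w45b-lead-2 g2 (lead). OURS; elementary commutative algebra (Frobenius additivity + Krull's intersection theorem); AI-written.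
[cite: Matsumura1987, Thm. 8.10 (Krull intersection)] for the one external input, used through Mathlib's `Ideal.iInf_pow_eq_bot_of_isLocalRing`.

SETTING. `R` a Noetherian local ring of prime characteristic `p`, an algebra over a field `k` whose constants represent every residue
(`∀ r, ∃ λ, r − λ ∈ 𝔪` — the local ring at a closed point of a finite-type scheme over an algebraically closed `k`). CLAIM: an element `a ∈ R`
admitting a `p^j`-th root for every `j` is a constant. PROOF: `b_j^{p^j} = a`, `b_j = μ_j + m_j` (`m_j ∈ 𝔪`) ⇒ `a = μ_j^{p^j} + m_j^{p^j}`; the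
constants `μ_j^{p^j}` all equal the residue constant `λ` of `a` (constants differing by an element of `𝔪` are equal), so `a − λ ∈ 𝔪^{p^j}` for
every `j`, hence `a − λ ∈ ⋂ₙ 𝔪ⁿ = 0`.
* `algebraMap_eq_zero_of_mem_maximalIdeal` — a constant in `𝔪` is `0`;
* `mem_range_algebraMap_of_forall_pow_char_pow` — the claim;
* `mem_range_algebraMap_of_forall_pow` — the `ConeForm` spelling (`∀ e > 0, ∃ b, bᵉ = a`);
* `forall_pow_of_mem_range_algebraMap` — converse over an algebraically closed `k` (constants have all roots).
-/

set_option linter.dupNamespace false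

namespace Summit.ResolutionOfSingularities.ResolutionOfSingularities.Cruxes.EquisingularLiftNat.Sections

variable {k R : Type} [Field k] [CommRing R] [IsLocalRing R] [Algebra k R]

/-- A constant lying in the maximal ideal is zero (a non-zero constant is a unit). [OURS · elementary] -/
theorem algebraMap_eq_zero_of_mem_maximalIdeal {l : k} (h : algebraMap k R l ∈ IsLocalRing.maximalIdeal R) : l = 0 := by
  by_contra hl
  exact (IsLocalRing.mem_maximalIdeal _ |>.mp h) ((IsUnit.mk0 l hl).map (algebraMap k R))

/-- **Infinitely `p^j`-root-divisible elements are constants.** In a Noetherian local ring of prime characteristic `p` over a field `k` whose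
constants represent every residue, an element with a `p^j`-th root for every `j` lies in the image of `k`. [OURS · Frobenius + Krull] -/
theorem mem_range_algebraMap_of_forall_pow_char_pow [IsNoetherianRing R] (p : ℕ) [Fact p.Prime] [CharP R p]
    (hres : ∀ r : R, ∃ l : k, r - algebraMap k R l ∈ IsLocalRing.maximalIdeal R)
    {a : R} (ha : ∀ j : ℕ, ∃ b : R, b ^ (p ^ j) = a) : a ∈ (algebraMap k R).range := by
  obtain ⟨l, hl⟩ := hres a
  refine ⟨l, ?_⟩
  -- `a - l ∈ 𝔪^(p^j)` for every `j`
  have hmem : ∀ j : ℕ, a - algebraMap k R l ∈ IsLocalRing.maximalIdeal R ^ (p ^ j) := by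
    intro j
    obtain ⟨b, hb⟩ := ha j
    obtain ⟨μ, hμ⟩ := hres b
    set m := b - algebraMap k R μ with hm
    have hb' : b = algebraMap k R μ + m := by rw [hm]; ring
    have hfrob : a = algebraMap k R (μ ^ (p ^ j)) + m ^ (p ^ j) := by
      rw [← hb, hb', add_pow_char_pow, map_pow]
    -- the two constants `l` and `μ^(p^j)` have the same residue, hence are equal
    have hdiff : algebraMap k R (μ ^ (p ^ j) - l) ∈ IsLocalRing.maximalIdeal R := by
      have h1 : m ^ (p ^ j) ∈ IsLocalRing.maximalIdeal R :=
        Ideal.pow_mem_of_mem _ hμ _ (pow_pos (Fact.out : p.Prime).pos j)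
      have : algebraMap k R (μ ^ (p ^ j) - l) = (a - algebraMap k R l) - m ^ (p ^ j) := by
        rw [map_sub, hfrob]; ring
      rw [this]
      exact Ideal.sub_mem _ hl h1
    have hμl : μ ^ (p ^ j) = l := sub_eq_zero.mp (algebraMap_eq_zero_of_mem_maximalIdeal hdiff)
    have : a - algebraMap k R l = m ^ (p ^ j) := by rw [← hμl, hfrob]; ring
    rw [this]
    exact Ideal.pow_mem_pow hμ _
  -- Krull: `⋂ₙ 𝔪ⁿ = 0`
  have hkrull : (⨅ n : ℕ, IsLocalRing.maximalIdeal R ^ n) = ⊥ :=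
    Ideal.iInf_pow_eq_bot_of_isLocalRing _ (Ideal.IsPrime.ne_top inferInstance)
  have hzero : a - algebraMap k R l ∈ (⨅ n : ℕ, IsLocalRing.maximalIdeal R ^ n) := by
    refine Ideal.mem_iInf.mpr fun n => ?_
    have hn : n ≤ p ^ n := (Nat.lt_pow_self (Fact.out : p.Prime).one_lt).le
    exact Ideal.pow_le_pow_right hn (hmem n)
  rw [hkrull, Ideal.mem_bot, sub_eq_zero] at hzero
  exact hzero.symm

/-- The `ConeForm` spelling: an element with an `e`-th root for EVERY `e ≥ 1` is a constant. [OURS · corollary] -/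
theorem mem_range_algebraMap_of_forall_pow [IsNoetherianRing R] (p : ℕ) [Fact p.Prime] [CharP R p]
    (hres : ∀ r : R, ∃ l : k, r - algebraMap k R l ∈ IsLocalRing.maximalIdeal R)
    {a : R} (ha : ∀ e : ℕ, 0 < e → ∃ b : R, b ^ e = a) : a ∈ (algebraMap k R).range :=
  mem_range_algebraMap_of_forall_pow_char_pow p hres fun j => ha (p ^ j) (pow_pos (Fact.out : p.Prime).pos j)

omit [IsLocalRing R] in
/-- Converse: over an algebraically closed `k`, constants have `e`-th roots for every `e ≥ 1`. [OURS · corollary of `IsAlgClosed.exists_pow_nat_eq`] -/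
theorem forall_pow_of_mem_range_algebraMap [IsAlgClosed k] {a : R} (ha : a ∈ (algebraMap k R).range) :
    ∀ e : ℕ, 0 < e → ∃ b : R, b ^ e = a := by
  intro e he
  obtain ⟨l, rfl⟩ := ha
  obtain ⟨m, hm⟩ := IsAlgClosed.exists_pow_nat_eq l he
  exact ⟨algebraMap k R m, by rw [← map_pow, hm]⟩

end Summit.ResolutionOfSingularities.ResolutionOfSingularities.Cruxes.EquisingularLiftNat.Sections
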